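import Literature.Geometry.Riemannian.GurskyViaclovskyClosednessChartEquation
import HarnessLib

/-!
# Gursky–Viaclovsky closedness: the symbol of the chart operator and its uniform ellipticity
# along the solutions

Support file (everything PROVED; no definition, no named fact) for the named fact
`Literature.Geometry.Riemannian.gurskyViaclovsky_pathClosed_weighted_four`. The chart form of the
background equation (`GurskyViaclovskyClosednessChartEquation.lean`) is
`chartOperator G t W y (DU) (D²U) = q̃ e^{4U}`. Gilbarg–Trudinger's structure condition (17.43)
for Thm. 17.14 asks for the uniform ellipticity of `∂F/∂r_{ij} ξ_iξ_j` ALONG the solution. Here: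

* `chartOperator_eq_sigma2_frame` — on an open `U ⊆ ℝ⁴` with metric `g` of components `G`, in
  a `g_y`-orthonormal frame `b`, for any jet `(p, r)` with `r` symmetric:
  `chartOperator G t W y p r = 4σ₂(M) − ¼W`, `M_{ac} = 𝒜^t(y,p,r)(b_a, b_c)`;
* `gvForm_add_right` — `𝒜^t(y, p, r + ρ) = 𝒜^t(y, p, r) + ρ + ((1−t)/2)(tr_G ρ) G`;
* `hasDerivAt_chartOperator` — **the symbol**: for a covector `η`,
  `d/dε|₀ chartOperator G t W y p (r + ε η ⊗ η) = 4 Σ_{ac} L^t(M)_{ac} ζ_a ζ_c`, `ζ_a = η(b_a)`,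
  `L^t = ellOp` (Gursky–Viaclovsky's Def. 2: "the first Newton transformation is what arises
  from differentiation of `σ₂`"; tree: `sigma2_smul_add_smul`, `quadForm_ellOp`);
* `symbol_uniformlyElliptic_along_solution` — along a smooth `u` with the fact's equation,
  admissibility and covariant bounds at the point `Φ y` of the preferred chart at `c`
  (`Φ = (chartAt c)⁻¹`), the symbol at the jet of `U = u ∘ Φ` satisfies
  `4λ Σζ_a² ≤ symbol ≤ 4Λ Σζ_a²` with the constants `λ, Λ` of
  `uniformlyElliptic_along_solution` (Ellipticity file) — (17.43) in the frame norm
  `Σ_a ζ_a² = |η|²_{g}`, which is comparable to the Euclidean `‖η‖²` on compact chart balls by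
  the coefficient bounds of `chart_c2_bounds` (ChartBounds file).

## References

* M. J. Gursky, J. A. Viaclovsky, J. Differential Geom. 63 (2003) 131–154, §2 Def. 2, Prop. 1–2,
  Prop. 6. [GurskyViaclovsky2003]
* D. Gilbarg, N. S. Trudinger, *Elliptic Partial Differential Equations of Second Order* (2001),
  §17.4, (17.43) and Thm. 17.14. [GilbargTrudinger2001]
-/

noncomputable section

open scoped Manifold ContDiff Topology
open Set Function Module Finset

namespace Literature.Geometry.Riemannian.GurskyViaclovskyPath

open Literature.Geometry.Lorentzian (PseudoRiemannianMetric)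
open Literature.Geometry.Lorentzian.PseudoRiemannianMetric
open Literature.Geometry.Lorentzian
open Literature.Geometry.Riemannian.GurskyViaclovsky

/-! ### Frame algebra of the symbol -/

section Algebra

/-- `8·σ₂(M, ζ⊗ζ + ((1−t)/2)|ζ|²δ) = 4·Σ L^t(M)_{ac} ζ_aζ_c` — the polarised `σ₂` against the
variation of Gursky–Viaclovsky's matrix is the quadratic form of `L^t(M) = T₁(M) +
((1−t)/2)σ₁(T₁(M))δ`. [cite: GurskyViaclovsky2003, §2, Def. 2] -/
theorem eight_mul_sigma2Polar_variation (t : ℝ) (M : Fin 4 → Fin 4 → ℝ) (ζ : Fin 4 → ℝ) :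
    8 * sigma2Polar M (fun a c ↦ ζ a * ζ c + (1 - t) / 2 * (∑ i, ζ i ^ 2) * frameDelta a c) =
      4 * quadForm (ellOp t M) ζ := by
  simp only [sigma2Polar, sigma1, frameInner, quadForm, ellOp, newtonT1, Fin.sum_univ_four,
    frameDelta, Fin.isValue, if_true, Fin.reduceEq, if_false]
  ring

/-- The variation array `ζ⊗ζ + c|ζ|²δ` is symmetric. [folklore] -/
theorem variation_symm (t : ℝ) (ζ : Fin 4 → ℝ) (a c : Fin 4) :
    (fun a c ↦ ζ a * ζ c + (1 - t) / 2 * (∑ i, ζ i ^ 2) * frameDelta a c) a c =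
      (fun a c ↦ ζ a * ζ c + (1 - t) / 2 * (∑ i, ζ i ^ 2) * frameDelta a c) c a := by
  simp only [mul_comm (ζ a) (ζ c), frameDelta_comm a c]

end Algebra

/-! ### The symbol on an open subset of `ℝ⁴` -/

section OpensChart

variable {U : TopologicalSpace.Opens (EuclideanSpace ℝ (Fin 4))}
  (g : PseudoRiemannianMetric 𝓘(ℝ, EuclideanSpace ℝ (Fin 4)) ∞ (EuclideanSpace ℝ (Fin 4))
    (TangentSpace 𝓘(ℝ, EuclideanSpace ℝ (Fin 4)) : U → Type _))
  [g.HasLeviCivita]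
  {G : EuclideanSpace ℝ (Fin 4) →
    EuclideanSpace ℝ (Fin 4) →L[ℝ] EuclideanSpace ℝ (Fin 4) →L[ℝ] ℝ}
  (hG : ∀ y : U, g.val y = G y)

/-- `𝒜^t(y, p, r + ρ) = 𝒜^t(y, p, r) + ρ + ((1−t)/2)(tr_G ρ) G(y)` — the form is affine in `r`.
[cite: GurskyViaclovsky2003, §1 (change1)] -/
theorem gvForm_add_right (t : ℝ) (y : EuclideanSpace ℝ (Fin 4)) (p : EuclideanSpace ℝ (Fin 4) →L[ℝ] ℝ)
    (r ρ : EuclideanSpace ℝ (Fin 4) →L[ℝ] EuclideanSpace ℝ (Fin 4) →L[ℝ] ℝ)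
    (v w : EuclideanSpace ℝ (Fin 4)) :
    gvForm G t y p (r + ρ) v w =
      gvForm G t y p r v w + (ρ v w + (1 - t) / 2 * MetricCoord.mtrAt G y ρ * G y v w) := by
  have hH : coordHess G y p (r + ρ) = coordHess G y p r + ρ := by
    simp only [coordHess]
    abel
  rw [gvForm_apply, gvForm_apply, hH, MetricCoord.mtrAt_add,
    show (coordHess G y p r + ρ) v w = coordHess G y p r v w + ρ v w from rfl]
  ring

include hG in
/-- **The chart operator in a frame, for an arbitrary symmetric jet**: in a `g_y`-orthonormal
frame `b`, `chartOperator G t W y p r = 4σ₂(M) − ¼W` with `M_{ac} = 𝒜^t(y,p,r)(b_a,b_c)`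
(metric trace and square norm of `𝒜` in the frame; symmetry of `M` from that of `r`, of the
Christoffel map, of `Ric(G)` and of `G`). [cite: GurskyViaclovsky2003, §1 (PDE)] -/
theorem chartOperator_eq_sigma2_frame (t W : ℝ) (y : U)
    {b : Basis (Fin 4) ℝ (TangentSpace 𝓘(ℝ, EuclideanSpace ℝ (Fin 4)) y)}
    (hb : g.IsOrthonormalFrame y b) (p : EuclideanSpace ℝ (Fin 4) →L[ℝ] ℝ)
    {r : EuclideanSpace ℝ (Fin 4) →L[ℝ] EuclideanSpace ℝ (Fin 4) →L[ℝ] ℝ} (hr : ∀ v w, r v w = r w v) :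
    chartOperator G t W y p r =
      4 * sigma2 (fun a c ↦ gvForm G t y p r (b a) (b c)) - W / 4 := by
  classical
  have hn : (2 : ℕ∞ω) ≤ ((⊤ : ℕ∞) : ℕ∞ω) := WithTop.coe_le_coe.mpr le_top
  have hmet : MetricCoord.IsMetricOn G (U : Set (EuclideanSpace ℝ (Fin 4))) :=
    OpensChart.isMetricOn_repr hG
  set 𝒜 := gvForm G t y p r with h𝒜
  set M : Fin 4 → Fin 4 → ℝ := fun a c ↦ 𝒜 (b a) (b c) with hM_def
  -- symmetry of `𝒜`
  have hGs : ∀ v w, G y v w = G y w v := fun v w ↦ hmet.symm y y.2 v w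
  have hRs : ∀ v w, MetricCoord.ricAt G y v w = MetricCoord.ricAt G y w v := fun v w ↦ by
    rw [← OpensChart.ricci_eq_ricAt hG y v w, ← OpensChart.ricci_eq_ricAt hG y w v]
    exact (g.ricci_symm_holds hn y).eq v w
  have hΓs : ∀ v w, MetricCoord.chrAt G y v w = MetricCoord.chrAt G y w v := fun v w ↦
    hmet.chrAt_comm y.2 v w
  have h𝒜s : ∀ v w, 𝒜 v w = 𝒜 w v := fun v w ↦ by
    rw [h𝒜, gvForm_apply, gvForm_apply, coordHess_apply, coordHess_apply, hGs v w, hRs v w,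
      hΓs v w, hr v w, mul_comm (p v) (p w)]
  have hMs : ∀ a c, M a c = M c a := fun a c ↦ h𝒜s (b a) (b c)
  -- trace and square norm in the frame
  have hO : (g.toBilinForm y).IsOrthoᵢ b := fun i j hij ↦ hb.2 i j hij
  have hcne : ∀ i, g.val y (b i) (b i) ≠ 0 := fun i ↦ by rw [hb.1 i]; exact one_ne_zero
  have htr : MetricCoord.mtrAt G y 𝒜 = ∑ a, M a a := by
    rw [← OpensChart.trace_eq_mtrAt hG y (toBilin 𝒜) 𝒜 (fun v w' ↦ rfl),
      g.trace_eq_sum_of_isOrthonormalFrame b hb]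
    rfl
  have hns : MetricCoord.normSqAt G y 𝒜 = frameNormSq M := by
    rw [← OpensChart.normSq_eq_normSqAt hG y (toBilin 𝒜) 𝒜 (fun v w' ↦ rfl),
      g.normSq_eq_sum_sq y b hO hcne, frameNormSq, Finset.sum_comm]
    refine Finset.sum_congr rfl fun a _ ↦ Finset.sum_congr rfl fun c _ ↦ ?_
    rw [hb.1 a, hb.1 c, mul_one, div_one]
    rfl
  rw [chartOperator, ← h𝒜, htr, hns, sigma2_eq hMs, sigma1]
  ring

include hG in
/-- **The symbol of the chart operator** (Gursky–Viaclovsky's Def. 2 / Prop. 2 read in a chart):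
for a covector `η` and a symmetric `r`,
`d/dε|₀ chartOperator G t W y p (r + ε η⊗η) = 4 Σ_{ac} L^t(M)_{ac} ζ_aζ_c`, `ζ_a = η(b_a)`,
`M_{ac} = 𝒜^t(y,p,r)(b_a,b_c)`. [cite: GurskyViaclovsky2003, §2, Def. 2 and Prop. 2] -/
theorem hasDerivAt_chartOperator (t W : ℝ) (y : U)
    {b : Basis (Fin 4) ℝ (TangentSpace 𝓘(ℝ, EuclideanSpace ℝ (Fin 4)) y)}
    (hb : g.IsOrthonormalFrame y b) (p : EuclideanSpace ℝ (Fin 4) →L[ℝ] ℝ)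
    {r : EuclideanSpace ℝ (Fin 4) →L[ℝ] EuclideanSpace ℝ (Fin 4) →L[ℝ] ℝ} (hr : ∀ v w, r v w = r w v)
    (η : EuclideanSpace ℝ (Fin 4) →L[ℝ] ℝ) :
    HasDerivAt (fun ε : ℝ ↦ chartOperator G t W y p (r + ε • η.smulRight η))
      (4 * quadForm (ellOp t fun a c ↦ gvForm G t y p r (b a) (b c)) fun a ↦ η (b a)) 0 := by
  classical
  set M : Fin 4 → Fin 4 → ℝ := fun a c ↦ gvForm G t y p r (b a) (b c) with hM_def
  set ζ : Fin 4 → ℝ := fun a ↦ η (b a) with hζ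
  set N : Fin 4 → Fin 4 → ℝ :=
    fun a c ↦ ζ a * ζ c + (1 - t) / 2 * (∑ i, ζ i ^ 2) * frameDelta a c with hN_def
  -- symmetry of `M` through `chartOperator_eq_sigma2_frame`'s companion computation
  have hn : (2 : ℕ∞ω) ≤ ((⊤ : ℕ∞) : ℕ∞ω) := WithTop.coe_le_coe.mpr le_top
  have hmet : MetricCoord.IsMetricOn G (U : Set (EuclideanSpace ℝ (Fin 4))) :=
    OpensChart.isMetricOn_repr hG
  have hGs : ∀ v w, G y v w = G y w v := fun v w ↦ hmet.symm y y.2 v w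
  have hRs : ∀ v w, MetricCoord.ricAt G y v w = MetricCoord.ricAt G y w v := fun v w ↦ by
    rw [← OpensChart.ricci_eq_ricAt hG y v w, ← OpensChart.ricci_eq_ricAt hG y w v]
    exact (g.ricci_symm_holds hn y).eq v w
  have hΓs : ∀ v w, MetricCoord.chrAt G y v w = MetricCoord.chrAt G y w v := fun v w ↦
    hmet.chrAt_comm y.2 v w
  have hMs : ∀ a c, M a c = M c a := fun a c ↦ by
    simp only [hM_def]
    rw [gvForm_apply, gvForm_apply, coordHess_apply, coordHess_apply, hGs (b a) (b c),
      hRs (b a) (b c), hΓs (b a) (b c), hr (b a) (b c), mul_comm (p (b a)) (p (b c))]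
  have hNs : ∀ a c, N a c = N c a := variation_symm t ζ
  -- `tr_G (η ⊗ η) = Σ ζ_a²` and `G(b_a, b_c) = δ_{ac}`
  have hδ : ∀ a c, G y (b a) (b c) = frameDelta a c := fun a c ↦ by
    have h1 : G y (b a) (b c) = g.val y (b a) (b c) :=
      (congrArg (fun B : EuclideanSpace ℝ (Fin 4) →L[ℝ] EuclideanSpace ℝ (Fin 4) →L[ℝ] ℝ ↦
        B (b a) (b c)) (hG y)).symm
    rw [h1]
    unfold frameDelta
    split_ifs with hac
    · subst hac; exact hb.1 a
    · exact hb.2 a c hac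
  have htrη : MetricCoord.mtrAt G y (η.smulRight η) = ∑ i, ζ i ^ 2 := by
    rw [← OpensChart.trace_eq_mtrAt hG y (toBilin (η.smulRight η)) _ (fun v w' ↦ rfl),
      g.trace_eq_sum_of_isOrthonormalFrame b hb]
    refine Finset.sum_congr rfl fun i _ ↦ ?_
    show η (b i) * η (b i) = _
    rw [hζ, sq]
  -- the frame array along the line `r + ε η⊗η`
  have hsymε : ∀ ε : ℝ, ∀ v w, (r + ε • η.smulRight η) v w = (r + ε • η.smulRight η) w v := by
    intro ε v w
    have e1 : (r + ε • η.smulRight η) v w = r v w + ε * (η v * η w) := rfl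
    have e2 : (r + ε • η.smulRight η) w v = r w v + ε * (η w * η v) := rfl
    rw [e1, e2, hr v w, mul_comm (η v) (η w)]
  have hline : ∀ ε : ℝ, chartOperator G t W y p (r + ε • η.smulRight η) =
      4 * sigma2 (fun a c ↦ 1 * M a c + ε * N a c) - W / 4 := by
    intro ε
    have harr : (fun a c ↦ gvForm G t y p (r + ε • η.smulRight η) (b a) (b c)) =
        fun a c ↦ 1 * M a c + ε * N a c := by
      funext a c
      have e3 : (ε • η.smulRight η) (b a) (b c) = ε * (η (b a) * η (b c)) := rfl
      rw [gvForm_add_right, MetricCoord.mtrAt_smul, htrη, hδ, e3]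
      simp only [hM_def, hN_def, hζ]
      ring
    rw [chartOperator_eq_sigma2_frame g hG t W y hb p (hsymε ε), harr]
  have hpoly : ∀ ε : ℝ, chartOperator G t W y p (r + ε • η.smulRight η) =
      (4 * sigma2 M - W / 4) + (8 * sigma2Polar M N) * ε + (4 * sigma2 N) * ε ^ 2 := by
    intro ε
    rw [hline ε, sigma2_smul_add_smul hMs hNs 1 ε]
    ring
  have h1 : HasDerivAt (fun ε : ℝ ↦ 8 * sigma2Polar M N * ε) (8 * sigma2Polar M N) 0 := by
    simpa using (hasDerivAt_id (0 : ℝ)).const_mul (8 * sigma2Polar M N)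
  have h2 : HasDerivAt (fun ε : ℝ ↦ 4 * sigma2 N * ε ^ 2) 0 0 := by
    simpa using (hasDerivAt_pow 2 (0 : ℝ)).const_mul (4 * sigma2 N)
  have hfun : (fun ε : ℝ ↦ chartOperator G t W y p (r + ε • η.smulRight η)) =
      fun ε ↦ (4 * sigma2 M - W / 4) + (8 * sigma2Polar M N * ε + 4 * sigma2 N * ε ^ 2) := by
    funext ε
    rw [hpoly]
    ring
  rw [hfun, ← eight_mul_sigma2Polar_variation t M ζ]
  have h := (h1.add h2).const_add (4 * sigma2 M - W / 4)
  rwa [add_zero] at h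

include hG in
/-- **The frame array of `𝒜^t` at the jet of a function is Gursky–Viaclovsky's matrix** of the
covariant frame data (the identification inside `backgroundPathOperator_eq_chartOperator`,
exported): for `f : U → ℝ` smooth with representative `F` and a `g_y`-orthonormal frame `b`,
`𝒜^t(y, DF(y), D²F(y))(b_a, b_c) = gvMatrix t R Rc H b` with `Rc_{ac} = Ric_g(b_a,b_c)`,
`R = R_g(y)`, `H_{ac} = Hess_g(−f)(b_a,b_c)`, `b_a = d(−f)(b_a)`.
[cite: GurskyViaclovsky2003, §1 (change1)] -/
theorem gvForm_frame_eq_gvMatrix (t : ℝ) {f : U → ℝ} {F : EuclideanSpace ℝ (Fin 4) → ℝ}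
    (hfF : ∀ y : U, f y = F y) (y : U) (hF : ContDiffAt ℝ 2 F y)
    {b : Basis (Fin 4) ℝ (TangentSpace 𝓘(ℝ, EuclideanSpace ℝ (Fin 4)) y)}
    (hb : g.IsOrthonormalFrame y b) (a c : Fin 4) :
    gvForm G t y (fderiv ℝ F y) (fderiv ℝ (fderiv ℝ F) y) (b a) (b c) =
      gvMatrix t (g.scalarCurvature y) (fun a c ↦ g.ricci y (b a) (b c))
        (fun a c ↦ g.hessian (fun z ↦ -f z) y (b a) (b c))
        (fun a ↦ mvfderiv 𝓘(ℝ, EuclideanSpace ℝ (Fin 4)) (fun z ↦ -f z) y (b a)) a c := by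
  classical
  have hδ : G y (b a) (b c) = frameDelta a c := by
    have h1 : G y (b a) (b c) = g.val y (b a) (b c) :=
      (congrArg (fun B : EuclideanSpace ℝ (Fin 4) →L[ℝ] EuclideanSpace ℝ (Fin 4) →L[ℝ] ℝ ↦
        B (b a) (b c)) (hG y)).symm
    rw [h1]
    unfold frameDelta
    split_ifs with hac
    · subst hac; exact hb.1 a
    · exact hb.2 a c hac
  have hric : MetricCoord.ricAt G y (b a) (b c) = g.ricci y (b a) (b c) :=
    (OpensChart.ricci_eq_ricAt hG y (b a) (b c)).symm
  have hscal : MetricCoord.scalAt G y = g.scalarCurvature y :=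
    (OpensChart.scalarCurvature_eq_scalAt hG y).symm
  have hHess : coordHess G y (fderiv ℝ F y) (fderiv ℝ (fderiv ℝ F) y) (b a) (b c) =
      -g.hessian (fun z ↦ -f z) y (b a) (b c) := by
    rw [coordHess_jet, ← OpensChart.hessian_eq_hessAt hG y hfF hF (b a) (b c)]
    change _ = -(g.hessian (-f) y (b a) (b c))
    rw [g.hessian_neg f y]
    simp
  have hmtr : MetricCoord.mtrAt G y (coordHess G y (fderiv ℝ F y) (fderiv ℝ (fderiv ℝ F) y)) =
      -∑ i, g.hessian (fun z ↦ -f z) y (b i) (b i) := by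
    rw [coordHess_jet]
    change MetricCoord.lapAt G F y = _
    rw [← OpensChart.dalembertian_eq_lapAt hG y hfF hF, dalembertian_eq_sum_orthonormalFrame g f hb,
      ← Finset.sum_neg_distrib]
    refine Finset.sum_congr rfl fun i _ ↦ ?_
    change _ = -(g.hessian (-f) y (b i) (b i))
    rw [g.hessian_neg f y]
    simp
  have hmv : mvfderiv 𝓘(ℝ, EuclideanSpace ℝ (Fin 4)) f y = fderiv ℝ F y :=
    ContinuousLinearMap.ext (OpensChart.mvfderiv_eq y f F hfF (hF.differentiableAt (by norm_num)))
  have hp : ∀ i, fderiv ℝ F y (b i) =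
      -mvfderiv 𝓘(ℝ, EuclideanSpace ℝ (Fin 4)) (fun z ↦ -f z) y (b i) := fun i ↦ by
    change _ = -(mvfderiv 𝓘(ℝ, EuclideanSpace ℝ (Fin 4)) (-f) y (b i))
    rw [mvfderiv_neg, ← OpensChart.mvfderiv_eq y f F hfF (hF.differentiableAt (by norm_num))]
    simp
  have hgrad : fderiv ℝ F y (MetricCoord.sharpAt G y (fderiv ℝ F y)) =
      ∑ i, mvfderiv 𝓘(ℝ, EuclideanSpace ℝ (Fin 4)) (fun z ↦ -f z) y (b i) ^ 2 := by
    have h1 : g.gradSq f y = ∑ i, mvfderiv 𝓘(ℝ, EuclideanSpace ℝ (Fin 4)) (fun z ↦ -f z) y (b i) ^ 2 := by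
      rw [gradSq_eq_sum_orthonormalFrame g f hb]
      refine Finset.sum_congr rfl fun i _ ↦ ?_
      change _ = (mvfderiv 𝓘(ℝ, EuclideanSpace ℝ (Fin 4)) (-f) y (b i)) ^ 2
      rw [mvfderiv_neg]
      simp
    rw [← h1, PseudoRiemannianMetric.gradSq_eq, ← OpensChart.sharp_eq_sharpAt hG y, ← hmv]
    rfl
  rw [gvForm_apply, hric, hscal, hδ, hHess, hmtr, hp, hp, hgrad, gvMatrix]
  ring

include hG in
/-- **Uniform ellipticity of the symbol along the solutions** (GT's (17.43) for the chart form
of the background equation, in the frame norm). On an open `U ⊆ ℝ⁴` with a Riemannian metric `g`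
of components `G`, let `f` be smooth with representative `F`, solving at `y` the background
equation `backgroundPathOperator g t (−f) y = q(y)e^{4f(y)}` with `backgroundScalar g (−f) y > 0`,
`t ≤ 1`, `|t| ≤ T`, and the bounds `|f y| ≤ C`, `|∇f|²_g(y) ≤ C`, `|∇²f|²_g(y) ≤ C`,
`|Ric_g|²(y) ≤ P²`, `|R_g(y)| ≤ P`, `q y ≥ q₀ > 0`. Then the symbol
`S(η) = d/dε|₀ chartOperator G t W y (DF(y)) (D²F(y) + ε η⊗η)` (`hasDerivAt_chartOperator`)
satisfies `4λ Σ_a η(b_a)² ≤ S(η) ≤ 4Λ Σ_a η(b_a)²` with the constants `λ, Λ` of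
`uniformlyElliptic_along_solution`, depending only on `(q₀, C, P, T)`.
[cite: GurskyViaclovsky2003, Prop. 6 (proof)] [cite: GilbargTrudinger2001, §17.4, (17.43)] -/
theorem symbol_uniformlyElliptic_along_solution (hg : g.IsRiemannian) {f : U → ℝ}
    (hf : ContMDiff 𝓘(ℝ, EuclideanSpace ℝ (Fin 4)) 𝓘(ℝ) ∞ f) {F : EuclideanSpace ℝ (Fin 4) → ℝ}
    (hfF : ∀ y : U, f y = F y) {q : U → ℝ} {t q₀ C P T : ℝ} (ht : t ≤ 1) (htT : |t| ≤ T)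
    (hq₀ : 0 < q₀) (hC : 0 ≤ C) (hP : 0 ≤ P) (y : U) (hF : ContDiffAt ℝ 2 F y) (hqy : q₀ ≤ q y)
    (heq : backgroundPathOperator g t (fun z ↦ -f z) y = q y * Real.exp (-4 * (-f y)))
    (hpos : 0 < backgroundScalar g (fun z ↦ -f z) y)
    (hfy : |f y| ≤ C) (hgrad : g.gradSq f y ≤ C) (hhess : g.normSq y (g.hessian f y) ≤ C)
    (hRic : g.normSq y (g.ricci y) ≤ P ^ 2) (hR : |g.scalarCurvature y| ≤ P)
    {b : Basis (Fin 4) ℝ (TangentSpace 𝓘(ℝ, EuclideanSpace ℝ (Fin 4)) y)}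
    (hb : g.IsOrthonormalFrame y b) (η : EuclideanSpace ℝ (Fin 4) →L[ℝ] ℝ) :
    4 * (q₀ * Real.exp (-4 * C) / 4 /
          (2 * (4 * ((1 + T) * P + (3 + 2 * T) * Real.sqrt C + (5 + 2 * T) * C) + 1))) *
        ∑ a, η (b a) ^ 2 ≤
      4 * quadForm (ellOp t fun a c ↦ gvForm G t y (fderiv ℝ F y) (fderiv ℝ (fderiv ℝ F) y)
        (b a) (b c)) (fun a ↦ η (b a)) ∧
    4 * quadForm (ellOp t fun a c ↦ gvForm G t y (fderiv ℝ F y) (fderiv ℝ (fderiv ℝ F) y)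
        (b a) (b c)) (fun a ↦ η (b a)) ≤
      4 * (3 * (4 * ((1 + T) * P + (3 + 2 * T) * Real.sqrt C + (5 + 2 * T) * C) + 1) * (2 - t)) *
        ∑ a, η (b a) ^ 2 := by
  have harr : (fun a c ↦ gvForm G t y (fderiv ℝ F y) (fderiv ℝ (fderiv ℝ F) y) (b a) (b c)) =
      gvMatrix t (g.scalarCurvature y) (fun a c ↦ g.ricci y (b a) (b c))
        (fun a c ↦ g.hessian (fun z ↦ -f z) y (b a) (b c))
        (fun a ↦ mvfderiv 𝓘(ℝ, EuclideanSpace ℝ (Fin 4)) (fun z ↦ -f z) y (b a)) := by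
    funext a c
    exact gvForm_frame_eq_gvMatrix g hG t hfF y hF hb a c
  have key := uniformlyElliptic_along_solution g hg hf ht htT hq₀ hC hP hqy heq hpos hfy hgrad
    hhess hRic hR hb (fun a ↦ η (b a))
  rw [harr]
  constructor
  · have h := mul_le_mul_of_nonneg_left key.1 (by norm_num : (0 : ℝ) ≤ 4)
    linarith
  · have h := mul_le_mul_of_nonneg_left key.2 (by norm_num : (0 : ℝ) ≤ 4)
    linarith


end OpensChart

end Literature.Geometry.Riemannian.GurskyViaclovskyPath

end
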